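import Literature.NumberTheory.Automorphic.UnitaryAdmissibleIrreducibleSubmoduleAnalytic -- part 1 (A-p14 (g26)): irreducible submodule of `H_K^∞`, analyticity, `IsInfUnitary`
import Literature.NumberTheory.Automorphic.UnitaryGlobalizationRecognition              -- ★ `isUnitaryGlobalization_of_recognition` (A-p03 (g22), brick «H»)
import Literature.NumberTheory.Automorphic.HilbertRepIsometricLieIntertwinerExtension     -- ★ `areUnitarilyEquivalent_closure_of_isometricLieIntertwiner` (A-p14 (g25), FILE 1)
import Literature.NumberTheory.Automorphic.UnitaryGlobalizationIrreducibleNoAdm            -- ★ `IsUnitaryGlobalization.isIrreducibleGK_harishChandra`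
import HarnessLib

/-!
# Harish-Chandra irreducibility for ADMISSIBLE unitary representations of `U(α, β)`: a topologically irreducible unitary representation whose
# Harish-Chandra module is `K`-admissible IS a unitary globalization of an irreducible admissible `(𝔤, K)`-class — its own Harish-Chandra module (part 2 of 2)

Topic `NumberTheory/Automorphic`; namespace `Literature.NumberTheory.Automorphic`.  THEOREMS ONLY (no definition, no instance, no notation, no named
fact, no `sorry`); axioms ⊆ {propext, Classical.choice, Quot.sound}.  Part 1 = ★ `UnitaryAdmissibleIrreducibleSubmoduleAnalytic` (irreducible submodule `U` of
`H_K^∞(ϖ)`, analyticity of its vectors).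

THE MATHEMATICS ([HarishChandra1953, §9: Thm. 5 and the discussion after Thm. 6; Thm. 8]; [KnappVogan1995, Thm. 0.6, §II.4]; [WallachRRG1, Thm. 3.4.11]).
Let `G = U(α, β)` (`α, β` non-empty), `ϖ` a UNITARY, STRONGLY CONTINUOUS, TOPOLOGICALLY IRREDUCIBLE representation of `G` on the Hilbert space `E` whose
Harish-Chandra module `H_K^∞(ϖ)` is ADMISSIBLE.  By part 1 there is an irreducible `(𝔤, K)`-submodule `U ≤ H_K^∞(ϖ)` all of whose vectors are analytic for
`ϖ`.  Hence (§3) the CLOSURE of `U` in `E` is a closed `G`-INVARIANT subspace (★ `areUnitarilyEquivalent_closure_of_isometricLieIntertwiner` with `T₀` the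
inclusion; `G` generated by `exp 𝔤`, hypothesis `hgen`, ★ in the tree for `U(2,1)`), non-zero, so by topological irreducibility `U` is DENSE; and (§4) the
RECOGNITION THEOREM ★ `isUnitaryGlobalization_of_recognition` applied to the admissible irreducible `U` densely and compatibly embedded in `E` gives
`IsUnitaryGlobalization G [U] ϖ` — in particular `H_K^∞(ϖ) ≅ U` is IRREDUCIBLE.  This is the `U(α, β)`-instance, UNDER ADMISSIBILITY, of the tree's named fact
★ `isIrreducibleGK_of_isTopIrreducible_unitary` (`GKModules` :456, general `G`, [HarishChandra1953 Thm. 5 ∕ §9]); admissibility itself ([HarishChandra1953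
Thms. 4–6], named fact ★ `isAdmissibleGK_of_irreducible_unitary`) is NOT proved here and enters as the hypothesis `hadm`.

* §3 `topologicalClosure_map_eq_top_of_irreducible_submodule` — an irreducible `(𝔤, K)`-submodule of `H_K^∞(ϖ)` is dense (`ϖ` topologically irreducible,
  `G` exp-generated).
* §4 **`exists_isUnitaryGlobalization_of_isAdmissibleGK`** — `∃ r : GKIrrep G, IsAdmissibleGK r.ρK ∧ IsInfUnitary r.ρK r.ρ𝔤 ∧ IsUnitaryGlobalization G [r] ϖ`;
  **`isIrreducibleGK_harishChandra_of_isAdmissibleGK`** — `H_K^∞(ϖ)` is irreducible; `isUnitaryGlobalization_harishChandra_of_isAdmissibleGK` — `ϖ` is a unitary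
  globalization of the class of its own Harish-Chandra module.

Cell `hodgecm-mathlib`, F0∕P3 ROAD «TF», (n1)-junction «L-iso class half» (A-p14 (g26) census 2026-09-01, FILE A part 2): consumed by the Summits-side junction
`F0P3ArchBlockClassOfArchIsotypy` (class of an admissible archimedean block of a discrete automorphic representation).  HC_CM is proved only modulo the 2
remaining named inputs (hLiu418, h413) until rung 0 closes; this file is unconditional.

## Mathlib ∕ tree search
Tree (all ★): `isUnitaryGlobalization_of_recognition` (`UnitaryGlobalizationRecognition`), `areUnitarilyEquivalent_closure_of_isometricLieIntertwiner`
(`HilbertRepIsometricLieIntertwinerExtension`), part 1 (`UnitaryAdmissibleIrreducibleSubmoduleAnalytic`), `GKSubmodule.isGKModule_sub` ∕ `subLie` (`GKSubquotient`),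
`isGKModule_harishChandra_holds` (`GKModulesProofs`), `hasDerivAt_dπ` ∕ `coe_harishChandraRepLie_apply` (`GKModulesSmoothVectorsProofs`),
`IsUnitaryGlobalization.isIrreducibleGK_harishChandra` (`UnitaryGlobalizationIrreducibleNoAdm`).  Mathlib: `IsSimpleOrder.eq_bot_or_eq_top`,
`Submodule.dense_iff_topologicalClosure_eq_top`, `LinearMap.range_comp`, `Submodule.range_subtype`.
Dedup: `rg -n "isUnitaryGlobalization_of_isTopIrreducible|isIrreducibleGK_harishChandra_of_isAdmissible|of_isAdmissibleGK_of_isTopIrreducible" lean/Literature lean/Summits` —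
no hits; the converse direction (globalization ⇒ topologically irreducible) is ★ `UnitaryGlobalizationIrreducibleProofs`.

## References
* Harish-Chandra, *Representations of a semisimple Lie group on a Banach space. I*, Trans. AMS 75 (1953), 185–243: §9 (Thm. 5, Thm. 6 and sequel, Thm. 8) [HarishChandra1953].
* A. W. Knapp, D. A. Vogan, *Cohomological Induction and Unitary Representations*, Princeton (1995), Introduction Thm. 0.6, §II.4 [KnappVogan1995].
* N. R. Wallach, *Real Reductive Groups I* (1988), §3.3.1, Thm. 3.4.11 [WallachRRG1].
-/

-- Mathlib idiom (Mathlib/Algebra/Lie/OfAssociative.lean; as in ★ `GKModules`): the commutator bracket on `Module.End ℂ V` ∕ `Matrix N N ℂ`, needed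
-- to MENTION `harishChandraRepLie … : 𝔤 →ₗ⁅ℝ⁆ Module.End ℂ _`.
attribute [local instance 100] LieRing.ofAssociativeRing

set_option autoImplicit false

noncomputable section

open scoped InnerProductSpace ComplexConjugate Matrix Matrix.Norms.Operator Nat
open Filter Topology

namespace Literature.NumberTheory.Automorphic

open Literature.RepresentationTheory Literature.RepresentationTheory.KonnoKonno2007 Literature.RepresentationTheory.KonnoKonno2007.RealDualPair
open Literature.RepresentationTheory.BorelWallach2000
open ContRepresentation (ClosedSubrep)

variable {α β : Type} [Fintype α] [DecidableEq α] [Fintype β] [DecidableEq β]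
  {E : Type} [NormedAddCommGroup E] [InnerProductSpace ℂ E] [CompleteSpace E]
  {ϖ : ContRepresentation ℂ (uFormGroup α β).carrier E}

/-! ## §3 An irreducible `(𝔤, K)`-submodule of `H_K^∞(ϖ)` is dense when `ϖ` is topologically irreducible -/

section Submodule

variable (hu : ϖ.IsUnitary) (hc : ϖ.IsStronglyContinuous)
  (U : Submodule ℂ (harishChandraSpace (uFormGroup α β) ϖ))
  (hUK : ∀ k : (uFormGroup α β).maximalCompact, U ≤ U.comap (harishChandraRepK (uFormGroup α β) ϖ k))
  (hU𝔤 : ∀ X : (uFormGroup α β).lie, U ≤ U.comap (harishChandraRepLie (uFormGroup α β) ϖ hc X))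
  (hirr : IsIrreducibleGK ((harishChandraRepK (uFormGroup α β) ϖ).subrepresentation U hUK)
    (GKSubmodule.subLie (uFormGroup α β) (harishChandraRepLie (uFormGroup α β) ϖ hc) U hU𝔤))



include hu hirr in
/-- **DENSITY**: for `ϖ` unitary, strongly continuous and TOPOLOGICALLY IRREDUCIBLE, and `G = U(α, β)` generated by its one-parameter subgroups (`hgen`), every
irreducible `(𝔤, K)`-submodule `U ≤ H_K^∞(ϖ)` is DENSE in `E`: its closure is a closed `G`-invariant subspace (★ `areUnitarilyEquivalent_closure_of_isometricLieIntertwiner`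
at the inclusion, analyticity §2), non-zero, hence everything. [cite: HarishChandra1953, §9 Thm. 8 (p. 230)] [cite: KnappVogan1995, §II.4] -/
theorem topologicalClosure_map_eq_top_of_irreducible_submodule [Nonempty α] [Nonempty β] (hirrϖ : ϖ.IsTopIrreducible)
    (hgen : ∀ M : Subgroup (uFormGroup α β).carrier, (∀ X : (uFormGroup α β).lie, (uFormGroup α β).expMem X ∈ M) → M = ⊤) :
    (U.map (harishChandraSpace (uFormGroup α β) ϖ).subtype).topologicalClosure = ⊤ := by
  set S : Submodule ℂ E := U.map (harishChandraSpace (uFormGroup α β) ϖ).subtype with hSdef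
  have hSsm : ∀ v ∈ S, v ∈ smoothVectors (uFormGroup α β) ϖ := by
    rintro _ ⟨v', -, rfl⟩
    exact v'.2.1
  have hS𝔤 : ∀ (X : (uFormGroup α β).lie), ∀ v ∈ S, dπ (uFormGroup α β) ϖ v X ∈ S := by
    rintro X _ ⟨v', hv'U, rfl⟩
    refine ⟨harishChandraRepLie (uFormGroup α β) ϖ hc X v', hU𝔤 X hv'U, ?_⟩
    exact coe_harishChandraRepLie_apply (uFormGroup α β) ϖ hc X v'
  let T₀ : S →ₗ[ℂ] E := S.subtype
  have hTsm : ∀ v : S, T₀ v ∈ smoothVectors (uFormGroup α β) ϖ := fun v => hSsm v v.2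
  have hT𝔤 : ∀ (X : (uFormGroup α β).lie) (v : S), dπ (uFormGroup α β) ϖ (T₀ v) X = T₀ ⟨dπ (uFormGroup α β) ϖ v X, hS𝔤 X v v.2⟩ :=
    fun X v => rfl
  have hTn : ∀ v : S, ‖T₀ v‖ = ‖(v : E)‖ := fun v => rfl
  have hana : ∀ v ∈ S, ∀ (u : E) (X : (uFormGroup α β).lie) (t₀ : ℝ),
      AnalyticAt ℝ (fun t : ℝ => ⟪u, ϖ ((uFormGroup α β).expMem (t • X)) v⟫_ℂ) t₀ := fun v hv u X t₀ =>
    analyticAt_inner_expMem_smul_apply_of_mem_irreducible_submodule hu hc U hUK hU𝔤 hirr hv u X t₀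
  have hana' : ∀ (v : S) (u' : E) (X : (uFormGroup α β).lie) (t₀ : ℝ),
      AnalyticAt ℝ (fun t : ℝ => ⟪u', ϖ ((uFormGroup α β).expMem (t • X)) (T₀ v)⟫_ℂ) t₀ := fun v u' X t₀ => hana v v.2 u' X t₀
  obtain ⟨C, -, hC, -, -⟩ :=
    areUnitarilyEquivalent_closure_of_isometricLieIntertwiner (ϖ := ϖ) (ϖ' := ϖ) hSsm hS𝔤 T₀ hTsm hT𝔤 hTn hana hana' hgen
  -- `C ≠ ⊥` (it contains the non-zero `S`), so `C = ⊤` by topological irreducibility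
  haveI := hirr.nontrivial
  obtain ⟨v₀, hv₀⟩ := exists_ne (0 : U)
  have hv₀S : (((v₀ : U) : harishChandraSpace (uFormGroup α β) ϖ) : E) ∈ S := ⟨(v₀ : harishChandraSpace (uFormGroup α β) ϖ), v₀.2, rfl⟩
  have hv₀C : (((v₀ : U) : harishChandraSpace (uFormGroup α β) ϖ) : E) ∈ C.toSubmodule := by
    rw [hC]
    exact S.le_topologicalClosure hv₀S
  have hv₀ne : (((v₀ : U) : harishChandraSpace (uFormGroup α β) ϖ) : E) ≠ 0 := fun h =>
    hv₀ (Subtype.ext (Subtype.ext (by simpa using h)))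
  haveI : IsSimpleOrder (ClosedSubrep ϖ) := hirrϖ
  rcases IsSimpleOrder.eq_bot_or_eq_top C with hbot | htop
  · exfalso
    rw [hbot] at hv₀C
    exact hv₀ne ((ClosedSubrep.mem_bot (π := ϖ)).mp hv₀C)
  · rw [← hC, htop]
    rfl

end Submodule


/-! ## §4 The recognition: `ϖ` is a unitary globalization of (the class of) an irreducible `(𝔤, K)`-submodule of its Harish-Chandra module -/

/-- **HARISH-CHANDRA IRREDUCIBILITY UNDER ADMISSIBILITY, GLOBALIZATION FORM.**  Let `ϖ` be a unitary, strongly continuous, topologically irreducible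
representation of `G = U(α, β)` (`α, β` non-empty, `G` generated by `exp 𝔤` — `hgen`, ★ for `U(2,1)`) on the Hilbert space `E` whose Harish-Chandra module is
`K`-admissible.  Then there is an irreducible ADMISSIBLE, INFINITESIMALLY UNITARY (★ `Liu2021.LemD2.IsInfUnitary`) `(𝔤, K)`-module `r` with `IsUnitaryGlobalization G [r] ϖ` —
namely any irreducible `(𝔤, K)`-submodule of `H_K^∞(ϖ)` (§1) with the restricted inner product, which is dense (§3) and `K`- and `𝔤`-compatibly embedded, so that ★
`isUnitaryGlobalization_of_recognition` applies.
[cite: HarishChandra1953, §9 (Thm. 5, Thm. 6 ff., Thm. 8)] [cite: KnappVogan1995, Thm. 0.6 and §II.4] [cite: WallachRRG1, Thm. 3.4.11] -/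
theorem exists_isUnitaryGlobalization_of_isAdmissibleGK [Nonempty α] [Nonempty β] (hu : ϖ.IsUnitary) (hc : ϖ.IsStronglyContinuous)
    (hirrϖ : ϖ.IsTopIrreducible)
    (hgen : ∀ M : Subgroup (uFormGroup α β).carrier, (∀ X : (uFormGroup α β).lie, (uFormGroup α β).expMem X ∈ M) → M = ⊤)
    (hadm : IsAdmissibleGK (harishChandraRepK (uFormGroup α β) ϖ)) :
    ∃ r : GKIrrep (uFormGroup α β), IsAdmissibleGK r.ρK ∧ Liu2021.LemD2.IsInfUnitary r.ρK r.ρ𝔤 ∧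
      IsUnitaryGlobalization (uFormGroup α β) (GKIrrClass.mk r) ϖ := by
  haveI : Nontrivial E := ((ContRepresentation.isTopIrreducible_iff ϖ).mp hirrϖ).1
  obtain ⟨U, hU, hirr⟩ := exists_isIrreducibleGK_submodule_harishChandra hu hc hadm
  have hUK : ∀ k : (uFormGroup α β).maximalCompact, U ≤ U.comap (harishChandraRepK (uFormGroup α β) ϖ k) := fun k u hu' => hU.1 k u hu'
  have hU𝔤 : ∀ X : (uFormGroup α β).lie, U ≤ U.comap (harishChandraRepLie (uFormGroup α β) ϖ hc X) := fun X u hu' => hU.2 X u hu'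
  have hV₀ : IsGKModule (uFormGroup α β) (harishChandraRepK (uFormGroup α β) ϖ) (harishChandraRepLie (uFormGroup α β) ϖ hc) :=
    isGKModule_harishChandra_holds (uFormGroup α β) ϖ hc _ (fun _ _ => rfl) (isHarishChandraModuleOf_harishChandraRepLie (uFormGroup α β) ϖ hc)
  have hV : IsGKModule (uFormGroup α β) ((harishChandraRepK (uFormGroup α β) ϖ).subrepresentation U hUK)
      (GKSubmodule.subLie (uFormGroup α β) (harishChandraRepLie (uFormGroup α β) ϖ hc) U hU𝔤) :=
    GKSubmodule.isGKModule_sub (uFormGroup α β) _ _ U hUK hU𝔤 hV₀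
  let r : GKIrrep (uFormGroup α β) :=
    { V := U
      ρK := (harishChandraRepK (uFormGroup α β) ϖ).subrepresentation U hUK
      ρ𝔤 := GKSubmodule.subLie (uFormGroup α β) (harishChandraRepLie (uFormGroup α β) ϖ hc) U hU𝔤
      isGKModule := hV
      isIrreducible := hirr }
  have hadm_r : IsAdmissibleGK r.ρK := isAdmissibleGK_subrepresentation hadm U hUK
  -- the embedding `ι : U ↪ E`
  let ι : U →ₗ[ℂ] E := (harishChandraSpace (uFormGroup α β) ϖ).subtype ∘ₗ U.subtype
  have hιi : Function.Injective ι := Subtype.val_injective.comp Subtype.val_injective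
  have hrange : LinearMap.range ι = U.map (harishChandraSpace (uFormGroup α β) ϖ).subtype := by
    rw [LinearMap.range_comp, Submodule.range_subtype]
  have hιd : DenseRange ι := by
    have h1 : Dense ((U.map (harishChandraSpace (uFormGroup α β) ϖ).subtype : Submodule ℂ E) : Set E) :=
      Submodule.dense_iff_topologicalClosure_eq_top.mpr
        (topologicalClosure_map_eq_top_of_irreducible_submodule hu hc U hUK hU𝔤 hirr hirrϖ hgen)
    rw [← hrange, LinearMap.coe_range] at h1
    exact h1
  have hK : ∀ (k : (uFormGroup α β).maximalCompact) (v : r.V),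
      ϖ (Subgroup.inclusion (uFormGroup α β).maximalCompact_le_carrier k) (ι v) = ι (r.ρK k v) := fun k v =>
    (coe_harishChandraRepK_apply (uFormGroup α β) ϖ k (v : harishChandraSpace (uFormGroup α β) ϖ)).symm
  have hD : ∀ X ∈ (Set.univ : Set (uFormGroup α β).lie), ∀ v : r.V,
      HasDerivAt (fun s : ℝ => ϖ ((uFormGroup α β).expMem (s • X)) (ι v)) (ι (r.ρ𝔤 X v)) 0 := fun X _ v => by
    have hd := hasDerivAt_dπ (uFormGroup α β) ϖ
      (differentiableAt_of_mem_smoothVectors (uFormGroup α β) ϖ (v : harishChandraSpace (uFormGroup α β) ϖ).2.1) X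
    have heq : ι (r.ρ𝔤 X v) = dπ (uFormGroup α β) ϖ ((v : harishChandraSpace (uFormGroup α β) ϖ) : E) X :=
      coe_harishChandraRepLie_apply (uFormGroup α β) ϖ hc X (v : harishChandraSpace (uFormGroup α β) ϖ)
    rw [heq]
    exact hd
  exact ⟨r, hadm_r, isInfUnitary_of_gkSubmodule_harishChandra hu hc U hUK hU𝔤,
    isUnitaryGlobalization_of_recognition (uFormGroup α β) r hadm_r ϖ hu hc ι hιi hιd hK Set.univ Submodule.span_univ hD⟩

/-- **HARISH-CHANDRA'S IRREDUCIBILITY THEOREM FOR ADMISSIBLE UNITARY REPRESENTATIONS OF `U(α, β)`**: the Harish-Chandra module `(H_K^∞(ϖ), ϖ|_K, dϖ)` of a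
unitary, strongly continuous, topologically irreducible representation with `K`-admissible Harish-Chandra module is an IRREDUCIBLE `(𝔤, K)`-module (the
`U(α, β)`-instance, under admissibility, of the named fact ★ `isIrreducibleGK_of_isTopIrreducible_unitary`). [cite: HarishChandra1953, §9 (Thm. 5, Thm. 6 ff.)]
[cite: WallachRRG1, Thm. 3.4.11] [cite: KnappVogan1995, Thm. 0.6] -/
theorem isIrreducibleGK_harishChandra_of_isAdmissibleGK [Nonempty α] [Nonempty β] (hu : ϖ.IsUnitary) (hc : ϖ.IsStronglyContinuous)
    (hirrϖ : ϖ.IsTopIrreducible)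
    (hgen : ∀ M : Subgroup (uFormGroup α β).carrier, (∀ X : (uFormGroup α β).lie, (uFormGroup α β).expMem X ∈ M) → M = ⊤)
    (hadm : IsAdmissibleGK (harishChandraRepK (uFormGroup α β) ϖ)) :
    IsIrreducibleGK (harishChandraRepK (uFormGroup α β) ϖ) (harishChandraRepLie (uFormGroup α β) ϖ hc) := by
  obtain ⟨r, -, -, hglob⟩ := exists_isUnitaryGlobalization_of_isAdmissibleGK hu hc hirrϖ hgen hadm
  exact hglob.isIrreducibleGK_harishChandra (uFormGroup α β)

/-- **`ϖ` IS A UNITARY GLOBALIZATION OF THE CLASS OF ITS OWN HARISH-CHANDRA MODULE** (unitary, strongly continuous, topologically irreducible, `K`-admissible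
Harish-Chandra module): with `r₀ := (H_K^∞(ϖ), ϖ|_K, dϖ)` (irreducible by `isIrreducibleGK_harishChandra_of_isAdmissibleGK`), `IsUnitaryGlobalization G [r₀] ϖ`.
[cite: HarishChandra1953, §9 (Thm. 5, Thm. 8)] [cite: KnappVogan1995, §II.4] -/
theorem isUnitaryGlobalization_harishChandra_of_isAdmissibleGK [Nonempty α] [Nonempty β] (hu : ϖ.IsUnitary) (hc : ϖ.IsStronglyContinuous)
    (hirrϖ : ϖ.IsTopIrreducible)
    (hgen : ∀ M : Subgroup (uFormGroup α β).carrier, (∀ X : (uFormGroup α β).lie, (uFormGroup α β).expMem X ∈ M) → M = ⊤)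
    (hadm : IsAdmissibleGK (harishChandraRepK (uFormGroup α β) ϖ)) :
    IsUnitaryGlobalization (uFormGroup α β)
      (GKIrrClass.mk
        { V := harishChandraSpace (uFormGroup α β) ϖ
          ρK := harishChandraRepK (uFormGroup α β) ϖ
          ρ𝔤 := harishChandraRepLie (uFormGroup α β) ϖ hc
          isGKModule := isGKModule_harishChandra_holds (uFormGroup α β) ϖ hc _ (fun _ _ => rfl)
            (isHarishChandraModuleOf_harishChandraRepLie (uFormGroup α β) ϖ hc)
          isIrreducible := isIrreducibleGK_harishChandra_of_isAdmissibleGK hu hc hirrϖ hgen hadm }) ϖ :=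
  ⟨hu, hc, _, rfl, AreGKEquivalent.refl _ _⟩

end Literature.NumberTheory.Automorphic

end
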